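import Literature.Probability.Process.ConformalMartingaleClock
import Literature.Probability.Process.BrownianVecStoppedIncrements
import Literature.Probability.Process.PlanarPotentials
import HarnessLib

/-!
# The conformal clock of planar Brownian motion: finiteness of the exit time, continuity,
# adaptedness and strict monotonicity

Second file on P. Lévy's conformal invariance of planar Brownian motion (Lawler (2005),
Thm. 2.2) for the planar Brownian motion `X = x₀ + W` of `IsBrownianVec`, stopped at the exit
time `ρ` of a bounded open set `U ∋ x₀` with `closure U ⊆ toC⁻¹ D` (`ConformalMartingaleClock`:
`stopT`, `confPos`, `confClock`, the exponential martingale). Here we establish the path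
properties of the clock `σ_t = ∫₀^{t∧ρ} |f'(X_r)|² dr` needed to invert it:

* `ae_hitTime_ne_top` — **the exit time of a bounded open set is a.s. finite** (Dynkin's
  formula for `|x|²`, whose Laplacian is `4`: `2 E[t ∧ ρ] ≤ diam²`, and Markov's inequality);
* `continuous_confClock` — the clock has continuous paths; `confClock_eq_of_le` — it is
  constant after `ρ`; `confClock_eq_integral_sub` — the identity
  `σ_{t∧ρ} = ∫₀ᵗ |f'(X_{r∧ρ})|² dr − (t − t∧ρ)|f'(X_{t∧ρ})|²`, whence
  `stronglyAdapted_confClock` — **the clock is adapted** to the natural filtration;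
* `confClock_sub_ge` — if `|f'|² ≥ m > 0` on `closure U`, then
  `σ_t − σ_s ≥ m ((t∧ρ) − (s∧ρ))`: the clock is strictly increasing up to `ρ`.

## References

* G. F. Lawler, *Conformally Invariant Processes in the Plane*, AMS (2005), Thm. 2.2.
* J.-F. Le Gall, *Brownian Motion, Martingales, and Stochastic Calculus* (2016), Prop. 5.14 /
  Thm. 5.13 (time change `inf{s : ⟨M⟩ₛ > t}`), Thm. 7.19.
-/

noncomputable section

open MeasureTheory Filter Topology Set Complex
open scoped NNReal ENNReal BigOperators ComplexConjugate

namespace Literature.Probability.Process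

variable {Ω : Type*} {mΩ : MeasurableSpace Ω} {P : Measure Ω} {W : ℝ≥0 → Ω → (Fin 2 → ℝ)}

namespace IsBrownianVec

variable {x₀ : Fin 2 → ℝ} {U : Set (Fin 2 → ℝ)} {D : Set ℂ} {f : ℂ → ℂ}

/-! ### The exit time of a bounded open set is almost surely finite -/

/-- **`E[t ∧ ρ_U] ≤ C` uniformly in `t`** for the exit time `ρ_U` of a bounded open `U ∋ x₀`
(Dynkin for `V(x) = |x|²`, `ΔV = 4`: `2E[t∧ρ] = E[V(X_{t∧ρ})] − V(x₀)`). [folklore] -/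
theorem integral_stopT_le [IsProbabilityMeasure P] (hW : IsBrownianVec W P) (hU : IsOpen U)
    (hUb : Bornology.IsBounded U) (hx₀ : x₀ ∈ U) :
    ∃ C : ℝ, ∀ t : ℝ≥0, Integrable (fun ω ↦ (stopT x₀ W U t ω : ℝ)) P ∧
      ∫ ω, (stopT x₀ W U t ω : ℝ) ∂P ≤ C := by
  set V : (Fin 2 → ℝ) → ℝ := fun v ↦ (v 0 - 0) ^ 2 + (v 1 - 0) ^ 2 with hV
  have hVc : ContDiffOn ℝ 2 V univ := (contDiff_sqDist 0 0).contDiffOn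
  have hΔ : ∀ y ∈ (univ : Set (Fin 2 → ℝ)), lap V y = 4 := fun y _ ↦ lap_sqDist 0 0 y
  have hK : IsCompact (closure U) := hUb.isCompact_closure
  obtain ⟨B, hB⟩ := hK.exists_bound_of_continuousOn ((contDiff_sqDist 0 0 (n := 0)).continuous.continuousOn)
  have hρ := hW.isStoppingTime_hitTime (x₀ := x₀) hU.isClosed_compl
  have h0 : IsStoppingTime hW.natFiltration (fun _ ↦ ((0 : ℝ≥0) : WithTop ℝ≥0)) :=
    isStoppingTime_const _ _
  refine ⟨(B + |V x₀|) / 2, fun t ↦ ?_⟩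
  have h := hW.setIntegral_stopped_sub_of_confined isOpen_univ hVc hΔ hK (subset_univ _)
    (x₀ := x₀) h0 hρ (fun ω ↦ bot_le) (A := univ) MeasurableSet.univ t
    (fun ω _ r _ hr ↦ hW.mem_closure_of_le hU hx₀ t ω hr)
  obtain ⟨hint, hzero⟩ := h
  simp only [Measure.restrict_univ, integrableOn_univ] at hint hzero
  have e0 : (min ((t : ℝ≥0) : WithTop ℝ≥0) ((0 : ℝ≥0) : WithTop ℝ≥0)).untopA = 0 := by
    rw [untopA_min_coe_coe, min_eq_right (show (0 : ℝ≥0) ≤ t from bot_le)]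
  simp only [e0, hW.apply_zero, add_zero, NNReal.coe_zero, sub_zero] at hint hzero
  -- abbreviations
  set Vt : Ω → ℝ := fun ω ↦ V (x₀ + W (min (t : WithTop ℝ≥0) (hitTime x₀ W Uᶜ ω)).untopA ω) with hVt
  set T : Ω → ℝ := fun ω ↦ ((min (t : WithTop ℝ≥0) (hitTime x₀ W Uᶜ ω)).untopA : ℝ) with hT
  have hTst : (fun ω ↦ (stopT x₀ W U t ω : ℝ)) = T := rfl
  have hVm : Measurable Vt :=
    (contDiff_sqDist 0 0 (n := 0)).continuous.measurable.comp (hW.measurable_stoppedProcess_path x₀ hρ t)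
  have hVb : ∀ ω, |Vt ω| ≤ B := fun ω ↦ by
    have := hB _ (hW.mem_closure_of_le hU hx₀ t ω le_rfl)
    rwa [Real.norm_eq_abs] at this
  have hVi : Integrable Vt P := integrable_of_abs_le hVm hVb
  have hint' : Integrable (fun ω ↦ Vt ω - V x₀ - 4 / 2 * T ω) P := hint
  have hzero' : ∫ ω, (Vt ω - V x₀ - 4 / 2 * T ω) ∂P = 0 := hzero
  have hTi : Integrable T P := by
    have h3 := (hVi.sub (integrable_const (V x₀))).sub hint'
    have h4 := h3.div_const (4 / 2)
    refine h4.congr (ae_of_all _ fun ω ↦ ?_)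
    simp only [Pi.sub_apply]
    ring
  rw [hTst]
  refine ⟨hTi, ?_⟩
  have e2 : ∫ ω, (Vt ω - V x₀ - 4 / 2 * T ω) ∂P = (∫ ω, Vt ω ∂P) - V x₀ - 4 / 2 * ∫ ω, T ω ∂P := by
    have i1 : ∫ ω, (Vt ω - V x₀ - 4 / 2 * T ω) ∂P =
        (∫ ω, (Vt ω - V x₀) ∂P) - ∫ ω, 4 / 2 * T ω ∂P :=
      integral_sub (hVi.sub (integrable_const _)) (hTi.const_mul _)
    have i2 : ∫ ω, (Vt ω - V x₀) ∂P = (∫ ω, Vt ω ∂P) - ∫ _ω, V x₀ ∂P := integral_sub hVi (integrable_const _)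
    rw [i1, i2, integral_const_mul, integral_const, smul_eq_mul, probReal_univ, one_mul]
  rw [e2] at hzero'
  have h6 : ∫ ω, Vt ω ∂P ≤ B := by
    have := integral_mono hVi (integrable_const B) fun ω ↦ le_of_abs_le (hVb ω)
    rwa [integral_const, smul_eq_mul, probReal_univ, one_mul] at this
  have h7 : ∫ ω, T ω ∂P = ((∫ ω, Vt ω ∂P) - V x₀) / 2 := by linarith
  rw [h7, div_le_div_iff_of_pos_right (by norm_num : (0 : ℝ) < 2)]
  linarith [neg_abs_le (V x₀)]

/-- **The exit time of a bounded open set by planar Brownian motion is a.s. finite.**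
[folklore] -/
theorem ae_hitTime_ne_top [IsProbabilityMeasure P] (hW : IsBrownianVec W P) (hU : IsOpen U)
    (hUb : Bornology.IsBounded U) (hx₀ : x₀ ∈ U) : ∀ᵐ ω ∂P, hitTime x₀ W Uᶜ ω ≠ ⊤ := by
  obtain ⟨C, hC⟩ := hW.integral_stopT_le hU hUb hx₀
  have hρ := hW.isStoppingTime_hitTime (x₀ := x₀) hU.isClosed_compl
  rw [ae_iff]
  simp only [not_not]
  -- `P(ρ = ⊤) ≤ P(t ≤ t ∧ ρ) ≤ C / t` for every `t > 0`
  have hle : ∀ t : ℝ≥0, 0 < t → P.real {ω | hitTime x₀ W Uᶜ ω = ⊤} ≤ C / t := by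
    intro t ht
    obtain ⟨hint, hCt⟩ := hC t
    have hsub : {ω | hitTime x₀ W Uᶜ ω = ⊤} ⊆ {ω | (t : ℝ) ≤ (stopT x₀ W U t ω : ℝ)} := by
      intro ω hω
      simp only [mem_setOf_eq] at hω ⊢
      rw [stopT, hω, untopA_min_coe_top]
    have hmk := mul_meas_ge_le_integral_of_nonneg (ae_of_all _ fun ω ↦ (stopT x₀ W U t ω).coe_nonneg)
      hint (t : ℝ)
    have ht' : (0 : ℝ) < t := ht
    calc P.real {ω | hitTime x₀ W Uᶜ ω = ⊤} ≤ P.real {ω | (t : ℝ) ≤ (stopT x₀ W U t ω : ℝ)} :=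
          measureReal_mono hsub
      _ ≤ (∫ ω, (stopT x₀ W U t ω : ℝ) ∂P) / t := by
          rw [le_div_iff₀ ht', mul_comm]; exact hmk
      _ ≤ C / t := div_le_div_of_nonneg_right hCt ht'.le
  -- let `t → ∞`
  have hlim : Tendsto (fun n : ℕ ↦ C / ((n : ℝ≥0) + 1 : ℝ≥0)) atTop (𝓝 0) := by
    have h1 : Tendsto (fun n : ℕ ↦ ((n : ℝ≥0) + 1 : ℝ≥0) : ℕ → ℝ) atTop atTop := by
      have : (fun n : ℕ ↦ (((n : ℝ≥0) + 1 : ℝ≥0) : ℝ)) = fun n : ℕ ↦ (n : ℝ) + 1 := by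
        funext n; push_cast; ring
      rw [this]
      exact tendsto_atTop_add_const_right _ 1 tendsto_natCast_atTop_atTop
    exact h1.const_div_atTop C
  have h0 : P.real {ω | hitTime x₀ W Uᶜ ω = ⊤} ≤ 0 :=
    ge_of_tendsto hlim (Eventually.of_forall fun n ↦ hle _ (by positivity))
  have h1 : P.real {ω | hitTime x₀ W Uᶜ ω = ⊤} = 0 := le_antisymm h0 measureReal_nonneg
  exact (measureReal_eq_zero_iff (measure_ne_top _ _)).1 h1

/-! ### Continuity of the clock; the clock after the exit time -/

section ClockPaths

/-- The clock integrand is continuous in real time. [folklore] -/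
theorem continuous_clockIntegrand (hW : IsBrownianVec W P) (hD : IsOpen D) (hf : DifferentiableOn ℂ f D)
    (hU : IsOpen U) (hUD : closure U ⊆ toC ⁻¹' D) (hx₀ : x₀ ∈ U) (ω : Ω) :
    Continuous (clockIntegrand x₀ W f U ω) :=
  hW.continuous_comp_confPos hU hUD hx₀ (continuousOn_deriv_sq hD hf) ω

/-- **The clock has continuous paths.** [folklore] -/
theorem continuous_confClock (hW : IsBrownianVec W P) (hD : IsOpen D) (hf : DifferentiableOn ℂ f D)
    (hU : IsOpen U) (hUD : closure U ⊆ toC ⁻¹' D) (hx₀ : x₀ ∈ U) (ω : Ω) :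
    Continuous fun t ↦ confClock x₀ W f U t ω := by
  have hc := hW.continuous_clockIntegrand hD hf hU hUD hx₀ ω
  have hprim : Continuous fun b : ℝ ↦ ∫ r in (0 : ℝ)..b, clockIntegrand x₀ W f U ω r :=
    intervalIntegral.continuous_primitive (fun a b ↦ hc.intervalIntegrable (μ := volume) a b) 0
  exact hprim.comp (NNReal.continuous_coe.comp (continuous_stopT ω))

/-- The clock is nondecreasing. [folklore] -/
theorem confClock_mono (hW : IsBrownianVec W P) (hD : IsOpen D) (hf : DifferentiableOn ℂ f D)
    (hU : IsOpen U) (hUD : closure U ⊆ toC ⁻¹' D) (hx₀ : x₀ ∈ U) (ω : Ω) {s t : ℝ≥0} (hst : s ≤ t) :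
    confClock x₀ W f U s ω ≤ confClock x₀ W f U t ω := by
  have h := hW.confClock_sub hD hf hU hUD hx₀ ω s t
  have hle : (stopT x₀ W U s ω : ℝ) ≤ stopT x₀ W U t ω := NNReal.coe_le_coe.2 (stopT_mono ω hst)
  have hnn : 0 ≤ ∫ r in (stopT x₀ W U s ω : ℝ)..(stopT x₀ W U t ω : ℝ),
      ‖deriv f (toC (confPos x₀ W U r.toNNReal ω))‖ ^ 2 :=
    intervalIntegral.integral_nonneg hle fun r _ ↦ by positivity
  linarith

/-- The stopped time against a finite exit time. [folklore] -/
theorem stopT_of_eq_coe {ω : Ω} {T : ℝ≥0} (h : hitTime x₀ W Uᶜ ω = T) (t : ℝ≥0) :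
    stopT x₀ W U t ω = min t T := by
  rw [stopT, h, untopA_min_coe_coe]

/-- The stopped time against an infinite exit time. [folklore] -/
theorem stopT_of_eq_top {ω : Ω} (h : hitTime x₀ W Uᶜ ω = ⊤) (t : ℝ≥0) : stopT x₀ W U t ω = t := by
  rw [stopT, h, untopA_min_coe_top]

/-- Before the exit time the stopped time is the time. [folklore] -/
theorem stopT_of_le {ω : Ω} {t : ℝ≥0} (h : (t : WithTop ℝ≥0) ≤ hitTime x₀ W Uᶜ ω) :
    stopT x₀ W U t ω = t := by
  induction hρ : hitTime x₀ W Uᶜ ω with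
  | top => exact stopT_of_eq_top hρ t
  | coe T =>
    rw [stopT_of_eq_coe hρ, min_eq_left]
    rw [hρ] at h
    exact WithTop.coe_le_coe.1 h

/-- **After the exit time the clock is constant**: `σ_t = σ_T` for `t ≥ T = ρ`. [folklore] -/
theorem confClock_eq_of_le {ω : Ω} {T : ℝ≥0} (h : hitTime x₀ W Uᶜ ω = T) {t : ℝ≥0} (ht : T ≤ t) :
    confClock x₀ W f U t ω = confClock x₀ W f U T ω := by
  rw [confClock, confClock, stopT_of_eq_coe h, stopT_of_eq_coe h, min_eq_right ht, min_self]

/-- The stopped position after the stopped time is the stopped position at the stopped time: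
`X_{r∧ρ} = X_{t∧ρ}` for `t ∧ ρ ≤ r ≤ t`. [folklore] -/
theorem confPos_of_ge {ω : Ω} {t r : ℝ≥0} (h1 : stopT x₀ W U t ω ≤ r) (h2 : r ≤ t) :
    confPos x₀ W U r ω = confPos x₀ W U t ω := by
  unfold confPos
  congr 1
  induction hρ : hitTime x₀ W Uᶜ ω with
  | top =>
    rw [stopT_of_eq_top hρ] at h1 ⊢
    rw [stopT_of_eq_top hρ, le_antisymm h2 h1]
  | coe T =>
    rw [stopT_of_eq_coe hρ] at h1 ⊢
    rw [stopT_of_eq_coe hρ]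
    rcases le_total t T with htT | hTt
    · rw [min_eq_left htT] at h1 ⊢
      rw [le_antisymm h2 h1, min_eq_left htT]
    · rw [min_eq_right hTt] at h1 ⊢
      rw [min_eq_right h1]

/-- **The clock as a difference of adapted quantities**:
`σ_{t∧ρ} = ∫₀ᵗ |f'(X_{r∧ρ})|² dr − (t − t∧ρ) |f'(X_{t∧ρ})|²`. [folklore] -/
theorem confClock_eq_integral_sub (hW : IsBrownianVec W P) (hD : IsOpen D) (hf : DifferentiableOn ℂ f D)
    (hU : IsOpen U) (hUD : closure U ⊆ toC ⁻¹' D) (hx₀ : x₀ ∈ U) (t : ℝ≥0) (ω : Ω) :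
    confClock x₀ W f U t ω = (∫ r in (0 : ℝ)..(t : ℝ), clockIntegrand x₀ W f U ω r) -
      ((t : ℝ) - stopT x₀ W U t ω) * ‖deriv f (toC (confPos x₀ W U t ω))‖ ^ 2 := by
  have hc := hW.continuous_clockIntegrand hD hf hU hUD hx₀ ω
  have hT : (stopT x₀ W U t ω : ℝ) ≤ t := NNReal.coe_le_coe.2 (stopT_le t ω)
  have hsplit := intervalIntegral.integral_add_adjacent_intervals
    (hc.intervalIntegrable (μ := volume) 0 (stopT x₀ W U t ω))
    (hc.intervalIntegrable (μ := volume) (stopT x₀ W U t ω) t)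
  have htail : ∫ r in (stopT x₀ W U t ω : ℝ)..(t : ℝ), clockIntegrand x₀ W f U ω r =
      ((t : ℝ) - stopT x₀ W U t ω) * ‖deriv f (toC (confPos x₀ W U t ω))‖ ^ 2 := by
    rw [intervalIntegral.integral_congr (g := fun _ ↦ ‖deriv f (toC (confPos x₀ W U t ω))‖ ^ 2),
      intervalIntegral.integral_const, smul_eq_mul]
    intro r hr
    rw [uIcc_of_le hT] at hr
    simp only [clockIntegrand]
    rw [confPos_of_ge (NNReal.le_toNNReal_of_coe_le hr.1) (Real.toNNReal_le_iff_le_coe.2 hr.2)]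
  rw [confClock_eq, ← hsplit, htail]
  ring

end ClockPaths

/-! ### The clock is adapted -/

section Adapted

/-- The stopped time `t ∧ ρ` is `𝓕_t`-measurable. [folklore] -/
theorem measurable_stopT (hW : IsBrownianVec W P) (hU : IsOpen U) (t : ℝ≥0) :
    Measurable[hW.natFiltration t] (stopT x₀ W U t) := by
  have hρ := hW.isStoppingTime_hitTime (x₀ := x₀) hU.isClosed_compl
  have hmin : IsStoppingTime hW.natFiltration fun ω ↦ min ((t : ℝ≥0) : WithTop ℝ≥0) (hitTime x₀ W Uᶜ ω) :=
    (isStoppingTime_const _ t).min hρ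
  have hm : Measurable[hW.natFiltration t] fun ω ↦ min ((t : ℝ≥0) : WithTop ℝ≥0) (hitTime x₀ W Uᶜ ω) :=
    hmin.measurable_of_le fun ω ↦ min_le_left _ _
  exact WithTop.measurable_untopA.comp hm

/-- The stopped position at a time `r ≤ t` is `𝓕_t`-measurable. [folklore] -/
theorem measurable_confPos_le (hW : IsBrownianVec W P) (hU : IsOpen U) {r t : ℝ≥0} (hrt : r ≤ t) :
    Measurable[hW.natFiltration t] (confPos x₀ W U r) :=
  ((hW.stronglyMeasurable_confPos hU r).measurable).mono (hW.natFiltration.mono hrt) le_rfl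

/-- `|f'|² ∘ toC` is measurable. [folklore] -/
theorem _root_.Literature.Probability.Process.measurable_deriv_sq (f : ℂ → ℂ) :
    Measurable fun y : Fin 2 → ℝ ↦ ‖deriv f (toC y)‖ ^ 2 :=
  ((measurable_deriv f).comp measurable_toC).norm.pow_const _

/-- The Riemann sums are `𝓕_t`-measurable. [folklore] -/
theorem measurable_clockRiemann (hW : IsBrownianVec W P) (hU : IsOpen U) (t : ℝ≥0) (n : ℕ) :
    Measurable[hW.natFiltration t] (clockRiemann x₀ W f U t n) := by
  refine Finset.measurable_sum _ fun k hk ↦ Measurable.const_mul ?_ _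
  rw [Finset.mem_range] at hk
  unfold clockIntegrand
  refine (measurable_deriv_sq f).comp (hW.measurable_confPos_le hU ?_)
  -- the grid point is at most `t`
  rcases Nat.eq_zero_or_pos n with rfl | hn
  · exact absurd hk (Nat.not_lt_zero _)
  · have hkn : (k : ℝ) / n ≤ 1 := by
      rw [div_le_one (by exact_mod_cast hn)]; exact_mod_cast hk.le
    have h1 : (0 + k * (((t : ℝ) - 0) / n)) ≤ t := by
      have : (0 + k * (((t : ℝ) - 0) / n)) = (k / n) * t := by ring
      rw [this]
      calc (k : ℝ) / n * t ≤ 1 * t := mul_le_mul_of_nonneg_right hkn t.coe_nonneg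
        _ = t := one_mul _
    exact Real.toNNReal_le_iff_le_coe.2 h1

/-- The integral `∫₀ᵗ |f'(X_{r∧ρ})|² dr` is `𝓕_t`-measurable (limit of Riemann sums). [folklore] -/
theorem stronglyMeasurable_integral_clockIntegrand (hW : IsBrownianVec W P) (hD : IsOpen D)
    (hf : DifferentiableOn ℂ f D) (hU : IsOpen U) (hUD : closure U ⊆ toC ⁻¹' D) (hx₀ : x₀ ∈ U) (t : ℝ≥0) :
    StronglyMeasurable[hW.natFiltration t] fun ω ↦ ∫ r in (0 : ℝ)..(t : ℝ), clockIntegrand x₀ W f U ω r := by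
  refine stronglyMeasurable_of_tendsto (f := fun n ↦ clockRiemann x₀ W f U t n) atTop
    (fun n ↦ (hW.measurable_clockRiemann hU t n).stronglyMeasurable) ?_
  rw [tendsto_pi_nhds]
  intro ω
  exact tendsto_riemannSum_of_continuousOn t.coe_nonneg
    (hW.continuous_clockIntegrand hD hf hU hUD hx₀ ω).continuousOn

/-- **The clock is adapted** to the natural filtration of `W`. [folklore] -/
theorem stronglyAdapted_confClock (hW : IsBrownianVec W P) (hD : IsOpen D) (hf : DifferentiableOn ℂ f D)
    (hU : IsOpen U) (hUD : closure U ⊆ toC ⁻¹' D) (hx₀ : x₀ ∈ U) :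
    StronglyAdapted hW.natFiltration (confClock x₀ W f U) := by
  intro t
  have e : confClock x₀ W f U t = fun ω ↦ (∫ r in (0 : ℝ)..(t : ℝ), clockIntegrand x₀ W f U ω r) -
      ((t : ℝ) - stopT x₀ W U t ω) * ‖deriv f (toC (confPos x₀ W U t ω))‖ ^ 2 :=
    funext fun ω ↦ hW.confClock_eq_integral_sub hD hf hU hUD hx₀ t ω
  rw [e]
  refine (hW.stronglyMeasurable_integral_clockIntegrand hD hf hU hUD hx₀ t).sub ?_
  refine Measurable.stronglyMeasurable ?_
  exact (measurable_const.sub (measurable_coe_nnreal_real.comp (hW.measurable_stopT hU t))).mul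
    ((measurable_deriv_sq f).comp (hW.measurable_confPos_le hU le_rfl))

/-- The clock is adapted (plain `Adapted` form). [folklore] -/
theorem adapted_confClock (hW : IsBrownianVec W P) (hD : IsOpen D) (hf : DifferentiableOn ℂ f D)
    (hU : IsOpen U) (hUD : closure U ⊆ toC ⁻¹' D) (hx₀ : x₀ ∈ U) :
    Adapted hW.natFiltration (confClock x₀ W f U) :=
  fun t ↦ (hW.stronglyAdapted_confClock hD hf hU hUD hx₀ t).measurable

end Adapted

/-! ### Strict monotonicity up to the exit time -/

/-- A positive lower bound for `|f'|²` on `closure U` when `f' ≠ 0` on `D`. [folklore] -/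
theorem exists_lower_bound_deriv_sq (hD : IsOpen D) (hf : DifferentiableOn ℂ f D)
    (hf' : ∀ z ∈ D, deriv f z ≠ 0) (hUc : IsCompact (closure U)) (hUD : closure U ⊆ toC ⁻¹' D)
    (hne : (closure U).Nonempty) :
    ∃ m : ℝ, 0 < m ∧ ∀ y ∈ closure U, m ≤ ‖deriv f (toC y)‖ ^ 2 := by
  have hc : ContinuousOn (fun y : Fin 2 → ℝ ↦ ‖deriv f (toC y)‖ ^ 2) (closure U) :=
    (continuousOn_deriv_sq hD hf).mono hUD
  obtain ⟨y₀, hy₀, hmin⟩ := hUc.exists_isMinOn hne hc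
  refine ⟨‖deriv f (toC y₀)‖ ^ 2, ?_, fun y hy ↦ hmin hy⟩
  have : deriv f (toC y₀) ≠ 0 := hf' _ (hUD hy₀)
  positivity

/-- **The clock increases at rate at least `m` before the exit time**:
`σ_t − σ_s ≥ m ((t∧ρ) − (s∧ρ))` when `|f'|² ≥ m` on `closure U`. [folklore] -/
theorem confClock_sub_ge (hW : IsBrownianVec W P) (hD : IsOpen D) (hf : DifferentiableOn ℂ f D)
    (hU : IsOpen U) (hUD : closure U ⊆ toC ⁻¹' D) (hx₀ : x₀ ∈ U) {m : ℝ}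
    (hm : ∀ y ∈ closure U, m ≤ ‖deriv f (toC y)‖ ^ 2) (ω : Ω) {s t : ℝ≥0} (hst : s ≤ t) :
    m * ((stopT x₀ W U t ω : ℝ) - stopT x₀ W U s ω) ≤ confClock x₀ W f U t ω - confClock x₀ W f U s ω := by
  rw [hW.confClock_sub hD hf hU hUD hx₀ ω s t]
  have hle : (stopT x₀ W U s ω : ℝ) ≤ stopT x₀ W U t ω := NNReal.coe_le_coe.2 (stopT_mono ω hst)
  have hc := hW.continuous_clockIntegrand hD hf hU hUD hx₀ ω
  have h := intervalIntegral.integral_mono_on hle (g := fun r ↦ ‖deriv f (toC (confPos x₀ W U r.toNNReal ω))‖ ^ 2)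
    (f := fun _ ↦ m) intervalIntegrable_const (hc.intervalIntegrable (μ := volume) _ _)
    (fun r _ ↦ hm _ (hW.confPos_mem_closure hU hx₀ _ ω))
  rwa [intervalIntegral.integral_const, smul_eq_mul, mul_comm] at h

end IsBrownianVec

end Literature.Probability.Process

end
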